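/-
Copyright (c) 2026 the pub-hodgecm-mathlib formalisation cell (harness21).  Prover seat hodgecm-mathlib-A-p12 (g22), 2026-09-01.  Road «S3-tree» (architect A-p16 (g30)
A-117 (2) ∕ A-125 (2) «(AS) HOLDER»), brick T3′ «depth-zero κ-transfer», THE TYPE-(2) ASSEMBLY (part 2∕2: the clause).
-/
import Literature.NumberTheory.Rogawski1990.DepthZeroKappaTransferTypeTwoGSide                 -- part 1∕2 (this seat): the G-side (R2² as the hypothesis `hrow2`) + the public near-1 package
import Literature.NumberTheory.Rogawski1990.DepthZeroKappaTransferTypeTwoRowTwo                -- ★ R2² `ncard_rankStrata_two_sub_eq_neg_one_pow_mul` (A-p19 (g26) ∕ F0P3b-p01 (g12) ∕ B-p14 (g37) ∕ F0P2-p06 (g11))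
import Literature.NumberTheory.Rogawski1990.UnitFundamentalLemmaExplicitNonsplitClosedProof    -- ★ the (P3)-irreducible template and its imports (exponents, `compactSpace_centralizer_of_not_exists_isRoot`)
import Literature.NumberTheory.Rogawski1990.DepthZeroTransferHValuesTypeTwoChi                 -- ★ p846348 H² `stableOrbitalIntegralRel_chiZero∕chiOne_eq_mul_phiHtwo…` (F0P3a-p03 (g15))
import Literature.NumberTheory.Rogawski1990.UnitaryVertexStabilizerSpanCM                      -- ★ `setOf_residuallyUnipotent_endoEmbLocal_mem_nhds_one` (A-p16 (g29))
import HarnessLib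

/-!
# T3′ (P-2): the depth-zero κ-transfer at the hyperspecial vertex, TYPE TWO — part 2∕2: the clause

Topic `NumberTheory/Rogawski1990`; namespace `Literature.NumberTheory.Rogawski1990`.  THEOREMS ONLY (no definition, no instance, no notation, no named fact, no `sorry`); kernel lane
`--supports stmt-HodgeConjecture-24833`.  Cell `pub/hodgecm-mathlib`, crux H413; road «S3-tree», brick T3′ «depth-zero κ-transfer» (DESIGN v2 §2 (P-2), HEAD v4),
END waypoint `localTransferAtOne_of_hyperspecialLevel_le_one` (F0P3a-p03 (g15): `stub_T3prime_typeTwo := depthZeroKappaTransfer_hyperspecial_typeTwo …`).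
HONEST LABEL: HC_CM is proved only modulo the cell's 2 remaining named inputs (hLiu418 24832, h413 24833) until rung 0 closes; this file asserts nothing printed — it is an
assembly of ★ organs.

THE STATEMENT (`depthZeroKappaTransfer_hyperspecial_typeTwo`, binders = HEAD v4 clause (P-2) = END v1-le1 `stub_T3prime_typeTwo` VERBATIM).  At an unramified non-split place
`v ∤ 2` of good reduction, for a depth-zero piece `g` at the hyperspecial vertex, arbitrary Haar measures `ν_H, ν_G` and the canonical orbital-measure families: there is
`V ∈ 𝓝 (1 : H_v)` such that for every `G`-regular `γ_H ∈ V` of TYPE TWO (`χ_{g,w}` has no root in `L_w`)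
  `Σᶠ_c Δ‴_v(γ_H, c)·Φ(c, g) = a₀·Φ^st(γ_H, χ₀) + a₁·Φ^st(γ_H, χ₁)`  (same `a₀, a₁, χ₀, χ₁` as type (1)).
THE PROOF.  `V :=` (residually-unipotent locus of `ι_v`, ★ `setOf_residuallyUnipotent_endoEmbLocal_mem_nhds_one`) ∩ (`g_w ≡ 1 (mod ϖ_v)` entrywise — ★ `continuous_fst_localMatrix`) ∩
(`u_w ≡ 1 (mod ϖ_v)` — ★ `eventually_nhds_one_valued_sub_one_le`; packaged as part 1∕2 §3 `setOf_entrywise_deep_mem_nhds_one`); `hint` ★ `v_charpoly_coeff_le_one_of_residuallyUnipotent`; exponents ★ `exists_irredExponents_of_hint`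
(`n ≤ 2N+1`, parity); `2 ≤ n`, `1 ≤ N`, `tr g_w ≡ 2`, `det g_w ≡ 1` from the entrywise depth (part 1∕2 §2); the G-side = part 1∕2; the H-side ★ `stableOrbitalIntegralRel_chiZero_eq_mul_phiHtwo_of_not_exists_isRoot`
∕ `…chiOne_eq_mul_phiHtwo_sub_…` (compact centraliser ★ `compactSpace_centralizer_of_not_exists_isRoot`); `ν_H(K_H) ≠ 0`; `push_cast; field_simp`.

## References
* [Rogawski1990] J. D. Rogawski, *Automorphic Representations of Unitary Groups in Three Variables*, Ann. of Math. Stud. 123 (1990): §4.9 Prop. 4.9.1 (a)(b) pp. 54–55,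
  Lemma 4.9.3 p. 56; §4.3 (4.3.1)–(4.3.2) p. 43; §8.1 Prop. 8.1.1 p. 112.
* [Flicker1998UnitaryFL] Y. Z. Flicker, *Elementary proof of the fundamental lemma for a unitary group*, Canad. J. Math. 50 (1998): Prop. 3 p. 78, §6 Thm. 18 p. 97.
* [LanglandsShelstad1987] R. P. Langlands, D. Shelstad, *On the definition of transfer factors*, Math. Ann. 278 (1987): §1.3–1.4.
* [Kottwitz1986] R. Kottwitz, *Base change for unit elements of Hecke algebras*, Compositio Math. 60 (1986): §3.
-/

set_option autoImplicit false

noncomputable section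

open MeasureTheory Measure Set Function NumberField IsDedekindDomain Matrix Polynomial Topology Filter
open Literature.NumberTheory.Automorphic Literature.NumberTheory.Automorphic.UnitaryGroup
open Literature.NumberTheory.Automorphic.IntegralReduction Literature.NumberTheory.GaloisRepresentations
open scoped Matrix MatrixGroups ValuativeRel

namespace Literature.NumberTheory.Rogawski1990

/-! ## The clause -/

set_option maxHeartbeats 800000 in
open scoped Classical in
/-- **T3′ HEAD v4, CLAUSE (P-2) TYPE TWO — PROVED** (see the module docstring; binders VERBATIM = END v1-le1 `stub_T3prime_typeTwo`).
[cite: Rogawski1990, §4.9 Prop. 4.9.1 (a)(b) p. 55; §4.3 (4.3.1)–(4.3.2) p. 43; §8.1 Prop. 8.1.1 p. 112] [cite: Flicker1998UnitaryFL, §6 Thm. 18 p. 97] [cite: LanglandsShelstad1987, §1.3–1.4]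
[cite: Kottwitz1986, §3] -/
theorem depthZeroKappaTransfer_hyperspecial_typeTwo
    (L : Type) [Field L] [NumberField L] [IsCMField L] (H' : Matrix (Fin 3) (Fin 3) L) (μ : HeckeCharacter L)
    {v : HeightOneSpectrum (𝓞 ↥(maximalRealSubfield L))}
    (hH' : (H'.map (cmConjRingHom L)).transpose = H') (w : PlacesOver L v)
    (hw : IsCMField.complexConj L • w.1 = w.1) (hv : Algebra.IsUnramifiedIn (𝓞 L) v.asIdeal)
    (hH'w : IsUnit (placeForm H' w.1)) (hH'i : hH'w.unit ∈ glInt 3 (w.1.adicCompletion L))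
    (hμ : μ.IsUnramifiedAt w.1) (hμu : μ.IsUnitary)
    (hμω : ∀ x : ideleGroup ↥(maximalRealSubfield L), μ (AdeleRing.ideleBaseChange ↥(maximalRealSubfield L) L x) = quadraticHeckeCharCM L x)
    (h2 : IsUnit (2 : 𝒪[w.1.adicCompletion L]))
    [MeasurableSpace ((cmDatum L 3 H').Local v)] [BorelSpace ((cmDatum L 3 H').Local v)]
    [∀ γ : ((cmDatum L 3 H').Local v), MeasurableSpace (((cmDatum L 3 H').Local v) ⧸ Subgroup.centralizer ({γ} : Set ((cmDatum L 3 H').Local v)))]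
    [∀ γ : ((cmDatum L 3 H').Local v), BorelSpace (((cmDatum L 3 H').Local v) ⧸ Subgroup.centralizer ({γ} : Set ((cmDatum L 3 H').Local v)))]
    [MeasurableSpace ((cmDatum L 2 (Matrix.of fun i j : Fin 2 => if i.val + j.val + 1 = 2 then (1 : L) else 0)).Local v ×
      (cmDatum L 1 (Matrix.of fun i j : Fin 1 => if i.val + j.val + 1 = 1 then (1 : L) else 0)).Local v)]
    [BorelSpace ((cmDatum L 2 (Matrix.of fun i j : Fin 2 => if i.val + j.val + 1 = 2 then (1 : L) else 0)).Local v ×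
      (cmDatum L 1 (Matrix.of fun i j : Fin 1 => if i.val + j.val + 1 = 1 then (1 : L) else 0)).Local v)]
    [∀ a : ((cmDatum L 2 (Matrix.of fun i j : Fin 2 => if i.val + j.val + 1 = 2 then (1 : L) else 0)).Local v ×
      (cmDatum L 1 (Matrix.of fun i j : Fin 1 => if i.val + j.val + 1 = 1 then (1 : L) else 0)).Local v),
      MeasurableSpace (((cmDatum L 2 (Matrix.of fun i j : Fin 2 => if i.val + j.val + 1 = 2 then (1 : L) else 0)).Local v ×
      (cmDatum L 1 (Matrix.of fun i j : Fin 1 => if i.val + j.val + 1 = 1 then (1 : L) else 0)).Local v) ⧸ Subgroup.centralizer ({a} : Set ((cmDatum L 2 (Matrix.of fun i j : Fin 2 => if i.val + j.val + 1 = 2 then (1 : L) else 0)).Local v ×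
      (cmDatum L 1 (Matrix.of fun i j : Fin 1 => if i.val + j.val + 1 = 1 then (1 : L) else 0)).Local v)))]
    [∀ a : ((cmDatum L 2 (Matrix.of fun i j : Fin 2 => if i.val + j.val + 1 = 2 then (1 : L) else 0)).Local v ×
      (cmDatum L 1 (Matrix.of fun i j : Fin 1 => if i.val + j.val + 1 = 1 then (1 : L) else 0)).Local v),
      BorelSpace (((cmDatum L 2 (Matrix.of fun i j : Fin 2 => if i.val + j.val + 1 = 2 then (1 : L) else 0)).Local v ×
      (cmDatum L 1 (Matrix.of fun i j : Fin 1 => if i.val + j.val + 1 = 1 then (1 : L) else 0)).Local v) ⧸ Subgroup.centralizer ({a} : Set ((cmDatum L 2 (Matrix.of fun i j : Fin 2 => if i.val + j.val + 1 = 2 then (1 : L) else 0)).Local v ×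
      (cmDatum L 1 (Matrix.of fun i j : Fin 1 => if i.val + j.val + 1 = 1 then (1 : L) else 0)).Local v)))]
    (νH : Measure ((cmDatum L 2 (Matrix.of fun i j : Fin 2 => if i.val + j.val + 1 = 2 then (1 : L) else 0)).Local v ×
      (cmDatum L 1 (Matrix.of fun i j : Fin 1 => if i.val + j.val + 1 = 1 then (1 : L) else 0)).Local v)) [νH.IsHaarMeasure] [νH.IsMulRightInvariant]
    (νG : Measure ((cmDatum L 3 H').Local v)) [νG.IsHaarMeasure] [νG.IsMulRightInvariant]
    {mH : OrbitalMeasureFamily ((cmDatum L 2 (Matrix.of fun i j : Fin 2 => if i.val + j.val + 1 = 2 then (1 : L) else 0)).Local v ×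
      (cmDatum L 1 (Matrix.of fun i j : Fin 1 => if i.val + j.val + 1 = 1 then (1 : L) else 0)).Local v)} {mG : OrbitalMeasureFamily ((cmDatum L 3 H').Local v)}
    (hmH : mH.IsCanonical (IsLocalGRegular L v) νH)
    (hmG : mG.IsCanonical (fun γ => IsRegularElt (γ.val : GL (Fin 3) (UnitaryGroup.LocalRing L v))) νG)
    -- the depth-zero piece at the hyperspecial vertex: `C_c^∞`, supported in `K`, constant on the residually-unipotent Jordan strata of `K`
    (g : ((cmDatum L 3 H').Local v) → ℂ) (hg : IsLocSmooth g) (hgK : tsupport g ⊆ (cmLocalIntegralLevel L 3 H' v : Set ((cmDatum L 3 H').Local v)))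
    (hginv : ∀ u ∈ cmLocalIntegralLevel L 3 H' v, ∀ x, g (u * x * u⁻¹) = g x)
    (c : ℕ → ℂ)
    (hc : ∀ k ∈ cmLocalIntegralLevel L 3 H' v,
      (redMat (((k.val : GL (Fin 3) (UnitaryGroup.LocalRing L v)).val.map (Pi.evalRingHom (fun w' : PlacesOver L v => w'.1.adicCompletion L) w))) - 1) ^ 3 = 0 →
      g k = c (redMat (((k.val : GL (Fin 3) (UnitaryGroup.LocalRing L v)).val.map (Pi.evalRingHom (fun w' : PlacesOver L v => w'.1.adicCompletion L) w))) - 1).rank) :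
    ∃ V ∈ 𝓝 (1 : ((cmDatum L 2 (Matrix.of fun i j : Fin 2 => if i.val + j.val + 1 = 2 then (1 : L) else 0)).Local v ×
        (cmDatum L 1 (Matrix.of fun i j : Fin 1 => if i.val + j.val + 1 = 1 then (1 : L) else 0)).Local v)),
      ∀ γH ∈ V, IsLocalGRegular L v γH →
        ¬ (∃ x : w.1.adicCompletion L, (((γH.1.val : GL (Fin 2) (UnitaryGroup.LocalRing L v)).val.map
          (Pi.evalRingHom (fun w' : PlacesOver L v => w'.1.adicCompletion L) w)).charpoly).IsRoot x) →
        ∑ᶠ cG : ConjClasses ((cmDatum L 3 H').Local v),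
            ((finExplicitCollection L H' μ (finExplicitDelta_conj_left_all L H' μ) (finExplicitDelta_conj_right_all L H' μ)) v).Δ γH (Quotient.out cG) *
              classOrbitalIntegral mG g cG =
          -- `a₀ · Φ^st(γH, χ₀)`, `a₀ = (ν_G(K)∕ν_H(K_H)) · (q⁻² c 0 + ((q²−1)∕q²) c 1)`, `χ₀ = 1_{{h ∈ K_H : h̄_W = 1}}`
          ((νG.real (cmLocalIntegralLevel L 3 H' v : Set ((cmDatum L 3 H').Local v)) / νH.real (((cmLocalIntegralLevel L 2 (Matrix.of fun i j : Fin 2 => if i.val + j.val + 1 = 2 then (1 : L) else 0) v).prod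
                (cmLocalIntegralLevel L 1 (Matrix.of fun i j : Fin 1 => if i.val + j.val + 1 = 1 then (1 : L) else 0) v) : Subgroup _) : Set _) : ℝ) : ℂ) * (((Ideal.absNorm v.asIdeal : ℂ) ^ 2)⁻¹ * c 0 + (((Ideal.absNorm v.asIdeal : ℂ) ^ 2 - 1) / (Ideal.absNorm v.asIdeal : ℂ) ^ 2) * c 1) *
              stableOrbitalIntegralRel (IsLocalStablyConjH L v) mH
                ((((cmLocalIntegralLevel L 2 (Matrix.of fun i j : Fin 2 => if i.val + j.val + 1 = 2 then (1 : L) else 0) v).prod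
                (cmLocalIntegralLevel L 1 (Matrix.of fun i j : Fin 1 => if i.val + j.val + 1 = 1 then (1 : L) else 0) v) : Subgroup _) : Set _).indicator
              (fun h => if (redMat (((h.1.val : GL (Fin 2) (UnitaryGroup.LocalRing L v)).val.map (Pi.evalRingHom (fun w' : PlacesOver L v => w'.1.adicCompletion L) w))) - 1) ^ 2 = 0 ∧ (redMat (((h.1.val : GL (Fin 2) (UnitaryGroup.LocalRing L v)).val.map (Pi.evalRingHom (fun w' : PlacesOver L v => w'.1.adicCompletion L) w))) - 1).rank = 0 then (1 : ℂ) else 0)) γH +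
          -- `a₁ · Φ^st(γH, χ₁)`, `a₁ = (ν_G(K)∕ν_H(K_H)) · (−q⁻¹ c 1 + ((q+1)∕q) c 2)`, `χ₁ = 1_{{h ∈ K_H : h̄_W unipotent, rank(h̄_W − 1) = 1}}`
          ((νG.real (cmLocalIntegralLevel L 3 H' v : Set ((cmDatum L 3 H').Local v)) / νH.real (((cmLocalIntegralLevel L 2 (Matrix.of fun i j : Fin 2 => if i.val + j.val + 1 = 2 then (1 : L) else 0) v).prod
                (cmLocalIntegralLevel L 1 (Matrix.of fun i j : Fin 1 => if i.val + j.val + 1 = 1 then (1 : L) else 0) v) : Subgroup _) : Set _) : ℝ) : ℂ) * (-((Ideal.absNorm v.asIdeal : ℂ))⁻¹ * c 1 + (((Ideal.absNorm v.asIdeal : ℂ) + 1) / (Ideal.absNorm v.asIdeal : ℂ)) * c 2) *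
              stableOrbitalIntegralRel (IsLocalStablyConjH L v) mH
                ((((cmLocalIntegralLevel L 2 (Matrix.of fun i j : Fin 2 => if i.val + j.val + 1 = 2 then (1 : L) else 0) v).prod
                (cmLocalIntegralLevel L 1 (Matrix.of fun i j : Fin 1 => if i.val + j.val + 1 = 1 then (1 : L) else 0) v) : Subgroup _) : Set _).indicator
              (fun h => if (redMat (((h.1.val : GL (Fin 2) (UnitaryGroup.LocalRing L v)).val.map (Pi.evalRingHom (fun w' : PlacesOver L v => w'.1.adicCompletion L) w))) - 1) ^ 2 = 0 ∧ (redMat (((h.1.val : GL (Fin 2) (UnitaryGroup.LocalRing L v)).val.map (Pi.evalRingHom (fun w' : PlacesOver L v => w'.1.adicCompletion L) w))) - 1).rank = 1 then (1 : ℂ) else 0)) γH := by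
  haveI := Literature.NumberTheory.Automorphic.isAdicComplete_maximalIdeal_valuedInteger_adicCompletion L w.1
  have _hμu := hμu  -- a binder of the clause text (HEAD v4 VERBATIM) not needed by the proof
  have hH'σ : (H'.map (IsCMField.complexConj L))ᵀ = H' := hH'
  have hiso := ValuativeRel.isEquiv (ValuativeRel.valuation (w.1.adicCompletion L))
    (Valued.v : Valuation (w.1.adicCompletion L) (WithZero (Multiplicative ℤ)))
  -- `H′` is invertible: its image over `L_w` is
  have hH'u : IsUnit H' := by
    rw [Matrix.isUnit_iff_isUnit_det]
    have h := (Matrix.isUnit_iff_isUnit_det _).1 hH'w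
    rw [show placeForm H' w.1 = (algebraMap L (w.1.adicCompletion L)).mapMatrix H' from rfl, ← RingHom.map_det] at h
    exact isUnit_iff_ne_zero.2 fun h0 => h.ne_zero (by rw [h0, map_zero])
  -- `2 ∈ 𝒪_w^×` in the `Valued` currency
  have h2w : Valued.v (2 : w.1.adicCompletion L) = 1 := (isUnit_two_integer_iff_valued_eq_one L w.1).1 h2
  have h2V : IsUnit (2 : Valued.integer (w.1.adicCompletion L)) := by
    have h := (Valuation.Integers.isUnit_iff_valuation_eq_one (Valuation.integer.integers _)).1 h2
    rw [Valuation.Integers.isUnit_iff_valuation_eq_one (Valuation.integer.integers _)]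
    rw [map_ofNat] at h ⊢
    exact (hiso.eq_one_iff_eq_one).1 h
  -- the mass `ν_H(K_H) ≠ 0`
  have hKHpos : νH.real ((cmLocalIntegralLevel L 2 (Matrix.of fun i j : Fin 2 => if i.val + j.val + 1 = 2 then (1 : L) else 0) v :
        Set ((cmDatum L 2 (Matrix.of fun i j : Fin 2 => if i.val + j.val + 1 = 2 then (1 : L) else 0)).Local v)) ×ˢ
      (cmLocalIntegralLevel L 1 (Matrix.of fun i j : Fin 1 => if i.val + j.val + 1 = 1 then (1 : L) else 0) v :
        Set ((cmDatum L 1 (Matrix.of fun i j : Fin 1 => if i.val + j.val + 1 = 1 then (1 : L) else 0)).Local v))) ≠ 0 := by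
    have hK2 := isCompact_isOpen_cmLocalIntegralLevel L 2 (Matrix.of fun i j : Fin 2 => if i.val + j.val + 1 = 2 then (1 : L) else 0) v
    have hK1 := isCompact_isOpen_cmLocalIntegralLevel L 1 (Matrix.of fun i j : Fin 1 => if i.val + j.val + 1 = 1 then (1 : L) else 0) v
    rw [measureReal_def]
    exact (ENNReal.toReal_pos ((hK2.2.prod hK1.2).measure_pos νH ⟨(1, 1), Subgroup.one_mem _, Subgroup.one_mem _⟩).ne'
      (hK2.1.prod hK1.1).measure_lt_top.ne).ne'
  -- the uniformizer `ϖ_v` read at `w` (`|ϖ|_w = q⁻¹`, `v` unramified in `L`)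
  have hϖ1 := Liu2021.LemD1IndexedNonVacuityInertCofinite.valued_toPlace_uniformizer_of_isUnramifiedIn L v hv w
  have hϖ0 : (toPlace v w (HeckeCharacter.uniformizer ↥(maximalRealSubfield L) v : v.adicCompletion ↥(maximalRealSubfield L))) ≠ 0 :=
    fun h0 => by rw [h0, map_zero] at hϖ1; exact WithZero.zero_ne_coe hϖ1
  -- (0) the neighbourhood: residually unipotent `ι_v(γ_H)`, and `g_w ≡ 1` entrywise, `u_w ≡ 1 (mod ϖ_v)` (part 1∕2 §3)
  have hV₁ := setOf_entrywise_deep_mem_nhds_one L v w hϖ0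
  refine ⟨_ ∩ _, Filter.inter_mem (setOf_residuallyUnipotent_endoEmbLocal_mem_nhds_one L v w) hV₁, ?_⟩
  intro γH hγV hreg hirr
  obtain ⟨hγ0, hγ1⟩ := hγV
  simp only [Set.mem_setOf_eq] at hγ0 hγ1
  have hg1 : ∀ i j, Valued.v ((((γH.1.val : GL (Fin 2) (LocalRing L v)).val.map (Pi.evalRingHom (fun w' : PlacesOver L v => w'.1.adicCompletion L) w)) - 1) i j) ≤
      WithZero.exp (-1 : ℤ) := fun i j => by rw [← hϖ1]; exact hγ1.1 i j
  have hu1 : Valued.v (finGammaTwo L v γH w - 1) ≤ WithZero.exp (-1 : ℤ) := by rw [← hϖ1]; exact hγ1.2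
  -- keep the (large) goal out of the eliminators' motives while gathering the data; it comes back at `apply hneg`
  by_contra hneg
  -- integrality of `charpoly(ι_v γ_H)_w` in both currencies
  have hintV : ∀ i : ℕ, ((((endoEmbLocal L v γH).val : GL (Fin 3) (UnitaryGroup.LocalRing L v)).val.map
      (Pi.evalRingHom (fun w' : PlacesOver L v => w'.1.adicCompletion L) w)).charpoly.coeff i) ∈ Valued.integer (w.1.adicCompletion L) :=
    fun i => (Valuation.mem_integer_iff _ _).2 (v_charpoly_coeff_le_one_of_residuallyUnipotent _ hγ0 i)
  have hint : ∀ i : ℕ, ((((endoEmbLocal L v γH).val : GL (Fin 3) (LocalRing L v)).val.map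
      (Pi.evalRingHom (fun w' : PlacesOver L v => w'.1.adicCompletion L) w)).charpoly.coeff i) ∈ 𝒪[w.1.adicCompletion L] :=
    fun i => (Valuation.mem_integer_iff _ _).2 ((hiso.le_one_iff_le_one).2 ((Valuation.mem_integer_iff _ _).1 (hintV i)))
  -- (1) the observable exponents `(n, N)` and their law
  obtain ⟨n, N, M, hn, hN, hlaw⟩ := exists_irredExponents_of_hint L v w hw γH hv h2V hintV hirr
  have hnN : n ≤ 2 * N + 1 := hlaw ▸ min_le_left _ _
  have hpar : Even n ∨ n = 2 * N + 1 := by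
    rcases le_total (2 * M) (2 * N + 1) with h | h
    · exact Or.inl ⟨M, by rw [hlaw, min_eq_right h]; ring⟩
    · exact Or.inr (by rw [hlaw, min_eq_left h])
  -- `2 ≤ n`, `1 ≤ N`, `tr ≡ 2`, `det ≡ 1` from the entrywise depth (§1)
  obtain ⟨hχ, hdisc, htr, hdet⟩ := valuation_quadratic_bounds_of_entrywise_deep
    (((γH.1.val : GL (Fin 2) (LocalRing L v)).val.map (Pi.evalRingHom (fun w' : PlacesOver L v => w'.1.adicCompletion L) w))) (finGammaTwo L v γH w) hg1 hu1
  have hn2 : 2 ≤ n := by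
    rw [← eval_finCharpolyTwo_finGammaTwo_apply_eq_quadratic, hn, WithZero.exp_le_exp] at hχ
    omega
  have hN1 : 1 ≤ N := by
    rw [hN, WithZero.exp_le_exp] at hdisc
    omega
  have htr' : Valued.v ((((γH.1.val : GL (Fin 2) (UnitaryGroup.LocalRing L v)).val.map (Pi.evalRingHom (fun w' : PlacesOver L v => w'.1.adicCompletion L) w))).trace - 2) < 1 :=
    lt_of_le_of_lt htr (by rw [← WithZero.exp_zero, WithZero.exp_lt_exp]; norm_num)
  have hdet' : Valued.v ((((γH.1.val : GL (Fin 2) (UnitaryGroup.LocalRing L v)).val.map (Pi.evalRingHom (fun w' : PlacesOver L v => w'.1.adicCompletion L) w))).det - 1) < 1 :=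
    lt_of_le_of_lt hdet (by rw [← WithZero.exp_zero, WithZero.exp_lt_exp]; norm_num)
  -- the compact centraliser of `γ₂` (anisotropic torus)
  haveI := compactSpace_centralizer_of_not_exists_isRoot L v w hw hv γH h2 hint hirr N hN
  -- (2)–(5) the G-side (part 1∕2) and the H-side values ★ H², then the mass algebra
  apply hneg
  rw [finsum_finExplicitDelta_mul_classOrbitalIntegral_depthZero_eq_of_irreducible L H' hH'σ w hw hv hH'w hH'i μ hμ
      (finExplicitDelta_conj_left_all L H' μ) (finExplicitDelta_conj_right_all L H' μ) hH'u hμω h2 hreg hirr hint hγ0 n N hn hN hn2 hN1 hnN hpar hg1 hu1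
      (fun δp hp hκp htp δm hm hκm htm => ncard_rankStrata_two_sub_eq_neg_one_pow_mul L H' hH'σ w hw hv hH'w hH'i h2 hreg hirr n N hn hN hN1
        δp hp hκp htp δm hm hκm htm)
      νG hmG g hg hgK hginv c hc,
    stableOrbitalIntegralRel_chiZero_eq_mul_phiHtwo_of_not_exists_isRoot L v w hw νH hv hmH hreg h2 hint hirr N hN hN1 htr' _,
    stableOrbitalIntegralRel_chiOne_eq_mul_phiHtwo_sub_of_not_exists_isRoot L v w hw νH hv hmH hreg h2 hint hirr N hN hN1 htr' hdet' _ _]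
  have hKHc := Complex.ofReal_ne_zero.2 hKHpos
  push_cast
  field_simp
  -- what is left: the decidability binders of ★ H²'s `χ₀`, `χ₁` (any instances)
  all_goals exact fun _ => inferInstance

end Literature.NumberTheory.Rogawski1990

end
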